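import Mathlib
import HarnessLib
import Summits.NavierStokesRegularity.NavierStokesRegularity.Theorems.PoloidalWindowDoorLrcModEntireTwistingTHLocalHypGerm
import Summits.NavierStokesRegularity.NavierStokesRegularity.Theorems.PoloidalWindowDoorLrcModEntireTwistingThickLeafwise
import Summits.NavierStokesRegularity.NavierStokesRegularity.Theorems.PoloidalWindowDoorLrcModEntireTHCertDictionary

/-!
# Route `PoloidalWindowDoor`, crux `PoloidalWindowRigidity` (stmt-19708) / item `LrcModEntire` (stmt-20428) —
# the local (TH)∩twisting statement MAY ASSUME A NON-UMBILIC BASE POINT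

Seat ns-poloidal-K2-p2 g7 (interim LEAD-of-record on 19708; file `--supports`).  The registered local target of the (TH)
column is `hemptyHyp` (= twist_split v4.1 `stub_localTHEmptyHyp` of item 20428, binder for binder; sign-free form `hempty`
= v4 `stub_localTHEmptyHyp` without its last hypothesis): «no real-analytic `(u, μ(t,z), A(t,z))` on an open `U ∋ p₀` with
`∂₀u₁ = ∂₁u₀`, `div u = 0`, `∂₂u_b = μ ∂_b u₂` (`b = 0,1`), the scalar law E, twist `≠ 0` at `p₀`, `μ(p₀) ∉ {0,1}`,
`∂_zμ(p₀) ≠ 0` (and `μ(p₀) < 0`)».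

The exact-elimination road to it (ns-poloidal-K2-cert-1 g4, CERT-MEMO-4 §0 (e4)) slaves the holomorphic tail of the jet scheme
to a finite core ON THE OPEN CONDITION `Φ₂(p₀) ≠ 0`, `Φ₂ = (∂₀u₀ − ∂₁u₁, 2∂₁u₀)` = trace-free horizontal strain (the
`ζ̄²`-coefficient `f₀₂` of the horizontal potential); the sub-branch `Φ₂ ≡ 0 near p₀` was left as «a hand case».  This file does
the hand case and the relocation, so that the registered statement may carry the extra pin:

* `horizFDeriv_vertStrain_eq_zero_of_umbilic` — KINEMATIC (only `∂₀u₁ = ∂₁u₀` and `div u = 0` are used): umbilic horizontal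
  strain on an open space–time set `V` (`∂₀u₀ = ∂₁u₁`, `∂₁u₀ = 0`) ⇒ `∂_b(∂₂u₂) = 0` on `V` (`b = 0,1`) — Clairaut:
  `∂₀(∂₀u₀ + ∂₁u₁) = 2∂₁(∂₀u₁) = 0`, `∂₁(∂₀u₀ + ∂₁u₁) = 2∂₀(∂₁u₀) = 0`, `∂₂u₂ = −(∂₀u₀ + ∂₁u₁)`; so the twist
  `∂₀(∂₂u₂)∂₁u₂ − ∂₁(∂₂u₂)∂₀u₂` vanishes identically on `V` (`twist_eq_zero_of_umbilic`).
* `localTHEmptyHyp_of_localTHEmptyHypNonUmbilic` — **`hemptyHyp` ⇐ `hemptyHypNU`**, `hemptyHypNU` := `hemptyHyp` with ONE MORE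
  hypothesis before `False`: `∂₀u₀(p₀) ≠ ∂₁u₁(p₀) ∨ ∂₁u₀(p₀) ≠ 0`.  Proof: the pins are open conditions (entries, twist, `μ` and
  `∂_zμ` along the shadow are continuous on `U` — jet-letter calculus of `…THCertDictionary`), so they hold on an open `G ∋ p₀`;
  either some `p₁ ∈ G` is non-umbilic (apply `hemptyHypNU` at `p₁`), or `G` is umbilic and the twist vanishes at `p₀`.
* `localTHEmpty_of_localTHEmptyNonUmbilic` — the same for the sign-free statement `hempty` (exact certificates are sign-blind).

So every certificate / hand argument for the (TH) column may start from a base point with `μ ∉ {0,1}` (`μ < 0`), `μ_z ≠ 0`,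
twist `≠ 0` AND `f₀₂ ≠ 0` — the pivot locus of CERT-MEMO-4 (e4); crux-19708 currency by composing with p581830
`…TwistingTHLocalHyp.stub_hyperbolicTH_of_localEmptyHyp`.  WHAT THIS IS NOT: not a proof of the stub and not a claim about
Navier–Stokes regularity — a free normalisation of the registered local statement (bears_on LADDER-NS N0 via 19708 / 20428).
-/

noncomputable section

-- the summit and its single sub-problem share the name (CONVENTIONS §1), as in every Theorems file
set_option linter.dupNamespace false

namespace Summit.NavierStokesRegularity.NavierStokesRegularity.Theorems.PoloidalWindowDoorLrcModEntireTwistingTHLocalNonUmbilic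

open Set Function Filter Topology Metric
open scoped RealInnerProductSpace InnerProductSpace Laplacian
open Literature.Analysis Literature.Analysis.FluidPDE
open Summit.NavierStokesRegularity.NavierStokesRegularity.Theorems.PoloidalWindowDoorLrcModEntireTwistingThickLeafwise
open Summit.NavierStokesRegularity.NavierStokesRegularity.Theorems.PoloidalWindowDoorLrcModEntireJetLetters
open Summit.NavierStokesRegularity.NavierStokesRegularity.Theorems.PoloidalWindowDoorLrcModEntireTHCertLetters
open Summit.NavierStokesRegularity.NavierStokesRegularity.Theorems.PoloidalWindowDoorLrcModEntireTHCertDictionary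
open Summit.NavierStokesRegularity.NavierStokesRegularity.Theorems.PoloidalWindowDoorPoloidalWindowRigiditySlopeFunctionSource

variable {u : ℝ → EuclideanSpace ℝ (Fin 3) → EuclideanSpace ℝ (Fin 3)} {μ : ℝ → ℝ → ℝ}
  {V : Set (ℝ × EuclideanSpace ℝ (Fin 3))}

/-! ### Slice calculus on an open space–time set -/

/-- Slices of a jointly real-analytic space–time field are real-analytic. [folklore] -/
theorem analyticAt_slice_of_mem (hu : AnalyticOnNhd ℝ (uncurry u) V) {p : ℝ × EuclideanSpace ℝ (Fin 3)} (hp : p ∈ V) :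
    AnalyticAt ℝ (u p.1) p.2 := by
  obtain ⟨t, x⟩ := p
  simpa [Function.comp_def] using (hu (t, x) hp).comp
    (analyticAt_const.prod analyticAt_id : AnalyticAt ℝ (fun y : EuclideanSpace ℝ (Fin 3) => ((t, y) : ℝ × _)) x)

/-- Slices of a jointly real-analytic space–time field are `C²` (any order). [folklore] -/
theorem contDiffAt_slice_of_mem (hu : AnalyticOnNhd ℝ (uncurry u) V) {p : ℝ × EuclideanSpace ℝ (Fin 3)} (hp : p ∈ V)
    {n : WithTop ℕ∞} : ContDiffAt ℝ n (u p.1) p.2 :=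
  (analyticAt_slice_of_mem hu hp).contDiffAt

/-- A scalar Jacobian entry `y ↦ D W(y)[e]_i` of a `C²` field is differentiable. [folklore] -/
theorem differentiableAt_entry {W : EuclideanSpace ℝ (Fin 3) → EuclideanSpace ℝ (Fin 3)} {x : EuclideanSpace ℝ (Fin 3)}
    (hW : ContDiffAt ℝ 2 W x) (e : EuclideanSpace ℝ (Fin 3)) (i : Fin 3) :
    DifferentiableAt ℝ (fun y => fderiv ℝ W y e i) x := by
  have hd : DifferentiableAt ℝ (fderiv ℝ W) x := (hW.fderiv_right (m := 1) (by norm_num)).differentiableAt one_ne_zero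
  have h1 : DifferentiableAt ℝ (fun y => fderiv ℝ W y e) x := hd.clm_apply (differentiableAt_const e)
  have e1 : (fun y => fderiv ℝ W y e i) =
      (EuclideanSpace.proj i : EuclideanSpace ℝ (Fin 3) →L[ℝ] ℝ) ∘ (fun y => fderiv ℝ W y e) := by
    funext y; rfl
  rw [e1]
  exact (EuclideanSpace.proj i).differentiableAt.comp x h1

/-! ### The umbilic branch is untwisted (kinematics only) -/

/-- **Umbilic horizontal strain ⇒ the vertical strain `∂₂u₂` is horizontally constant.**  Let `u` be jointly real-analytic on an
open space–time set `V` with `∂₀u₁ = ∂₁u₀` and `div u = 0` on `V`.  If the horizontal strain is umbilic on `V`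
(`∂₀u₀ = ∂₁u₁` and `∂₁u₀ = 0` at every point of `V`), then `∂_b(∂₂u₂) = 0` on `V` for `b = 0, 1`.  [folklore] -/
theorem horizFDeriv_vertStrain_eq_zero_of_umbilic (hV : IsOpen V) (hu : AnalyticOnNhd ℝ (uncurry u) V)
    (hpol : ∀ p ∈ V, fderiv ℝ (u p.1) p.2 (EuclideanSpace.single 0 1) 1 = fderiv ℝ (u p.1) p.2 (EuclideanSpace.single 1 1) 0)
    (hdiv : ∀ p ∈ V, fderiv ℝ (u p.1) p.2 (EuclideanSpace.single 0 1) 0 + fderiv ℝ (u p.1) p.2 (EuclideanSpace.single 1 1) 1 +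
      fderiv ℝ (u p.1) p.2 (EuclideanSpace.single 2 1) 2 = 0)
    (humb : ∀ p ∈ V, fderiv ℝ (u p.1) p.2 (EuclideanSpace.single 0 1) 0 = fderiv ℝ (u p.1) p.2 (EuclideanSpace.single 1 1) 1 ∧
      fderiv ℝ (u p.1) p.2 (EuclideanSpace.single 1 1) 0 = 0)
    {p : ℝ × EuclideanSpace ℝ (Fin 3)} (hp : p ∈ V) {b : Fin 3} (hb : b ≠ 2) :
    fderiv ℝ (fun y => fderiv ℝ (u p.1) y (EuclideanSpace.single 2 1) 2) p.2 (EuclideanSpace.single b 1) = 0 := by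
  obtain ⟨t, x⟩ := p
  -- the slice `{y | (t, y) ∈ V}` is a neighbourhood of `x`
  have hc : Continuous fun y : EuclideanSpace ℝ (Fin 3) => ((t, y) : ℝ × EuclideanSpace ℝ (Fin 3)) := by fun_prop
  have hN : {y : EuclideanSpace ℝ (Fin 3) | ((t, y) : ℝ × _) ∈ V} ∈ 𝓝 x := (hV.preimage hc).mem_nhds hp
  have hC2 : ContDiffAt ℝ 2 (u t) x := contDiffAt_slice_of_mem hu hp
  -- the identities as eventual equalities of slice functions near `x`
  have e_div : (fun y => fderiv ℝ (u t) y (EuclideanSpace.single 2 1) 2) =ᶠ[𝓝 x]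
      fun y => -(fderiv ℝ (u t) y (EuclideanSpace.single 0 1) 0 + fderiv ℝ (u t) y (EuclideanSpace.single 1 1) 1) := by
    filter_upwards [hN] with y hy
    have h := hdiv (t, y) hy
    dsimp only at h; linarith
  have e_umb : (fun y => fderiv ℝ (u t) y (EuclideanSpace.single 0 1) 0) =ᶠ[𝓝 x]
      fun y => fderiv ℝ (u t) y (EuclideanSpace.single 1 1) 1 := by
    filter_upwards [hN] with y hy using (humb (t, y) hy).1
  have e_10 : (fun y => fderiv ℝ (u t) y (EuclideanSpace.single 1 1) 0) =ᶠ[𝓝 x] fun _ => (0 : ℝ) := by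
    filter_upwards [hN] with y hy using (humb (t, y) hy).2
  have e_01 : (fun y => fderiv ℝ (u t) y (EuclideanSpace.single 0 1) 1) =ᶠ[𝓝 x] fun _ => (0 : ℝ) := by
    filter_upwards [hN] with y hy
    have h1 := hpol (t, y) hy
    have h2 := (humb (t, y) hy).2
    dsimp only at h1 h2; rw [h1, h2]
  -- derivatives of the two vanishing off-diagonal entries vanish
  have d10 : ∀ w, fderiv ℝ (fun y => fderiv ℝ (u t) y (EuclideanSpace.single 1 1) 0) x w = 0 := fun w => by
    rw [e_10.fderiv_eq]; simp
  have d01 : ∀ w, fderiv ℝ (fun y => fderiv ℝ (u t) y (EuclideanSpace.single 0 1) 1) x w = 0 := fun w => by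
    rw [e_01.fderiv_eq]; simp
  -- Clairaut: `∂₁(∂₀u₀) = ∂₀(∂₁u₀) = 0`, `∂₀(∂₁u₁) = ∂₁(∂₀u₁) = 0`
  have s00 : fderiv ℝ (fun y => fderiv ℝ (u t) y (EuclideanSpace.single 0 1) 0) x (EuclideanSpace.single 1 1) = 0 := by
    rw [fderiv_entry_symm hC2 (EuclideanSpace.single 0 1) (EuclideanSpace.single 1 1) 0]; exact d10 _
  have s11 : fderiv ℝ (fun y => fderiv ℝ (u t) y (EuclideanSpace.single 1 1) 1) x (EuclideanSpace.single 0 1) = 0 := by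
    rw [fderiv_entry_symm hC2 (EuclideanSpace.single 1 1) (EuclideanSpace.single 0 1) 1]; exact d01 _
  -- umbilicity moves the diagonal derivatives onto these
  have a00 : fderiv ℝ (fun y => fderiv ℝ (u t) y (EuclideanSpace.single 0 1) 0) x (EuclideanSpace.single 0 1) = 0 := by
    rw [e_umb.fderiv_eq]; exact s11
  have a11 : fderiv ℝ (fun y => fderiv ℝ (u t) y (EuclideanSpace.single 1 1) 1) x (EuclideanSpace.single 1 1) = 0 := by
    rw [← e_umb.fderiv_eq]; exact s00
  -- `∂₂u₂ = −(∂₀u₀ + ∂₁u₁)` near `x`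
  have hb' : b = 0 ∨ b = 1 := by fin_cases b <;> simp at hb ⊢
  have hF : HasFDerivAt
      (fun y => -(fderiv ℝ (u t) y (EuclideanSpace.single 0 1) 0 + fderiv ℝ (u t) y (EuclideanSpace.single 1 1) 1))
      (-(fderiv ℝ (fun y => fderiv ℝ (u t) y (EuclideanSpace.single 0 1) 0) x +
        fderiv ℝ (fun y => fderiv ℝ (u t) y (EuclideanSpace.single 1 1) 1) x)) x :=
    ((differentiableAt_entry hC2 _ 0).hasFDerivAt.add (differentiableAt_entry hC2 _ 1).hasFDerivAt).neg
  rw [e_div.fderiv_eq, hF.fderiv]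
  rcases hb' with rfl | rfl
  · simp [a00, s11]
  · simp [s00, a11]

/-- **The umbilic branch is untwisted**: under the hypotheses of `horizFDeriv_vertStrain_eq_zero_of_umbilic` the twist
`∂₀(∂₂u₂)·∂₁u₂ − ∂₁(∂₂u₂)·∂₀u₂` vanishes at every point of `V`. [folklore] -/
theorem twist_eq_zero_of_umbilic (hV : IsOpen V) (hu : AnalyticOnNhd ℝ (uncurry u) V)
    (hpol : ∀ p ∈ V, fderiv ℝ (u p.1) p.2 (EuclideanSpace.single 0 1) 1 = fderiv ℝ (u p.1) p.2 (EuclideanSpace.single 1 1) 0)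
    (hdiv : ∀ p ∈ V, fderiv ℝ (u p.1) p.2 (EuclideanSpace.single 0 1) 0 + fderiv ℝ (u p.1) p.2 (EuclideanSpace.single 1 1) 1 +
      fderiv ℝ (u p.1) p.2 (EuclideanSpace.single 2 1) 2 = 0)
    (humb : ∀ p ∈ V, fderiv ℝ (u p.1) p.2 (EuclideanSpace.single 0 1) 0 = fderiv ℝ (u p.1) p.2 (EuclideanSpace.single 1 1) 1 ∧
      fderiv ℝ (u p.1) p.2 (EuclideanSpace.single 1 1) 0 = 0)
    {p : ℝ × EuclideanSpace ℝ (Fin 3)} (hp : p ∈ V) :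
    fderiv ℝ (fun y => fderiv ℝ (u p.1) y (EuclideanSpace.single 2 1) 2) p.2 (EuclideanSpace.single 0 1) *
          fderiv ℝ (u p.1) p.2 (EuclideanSpace.single 1 1) 2 -
        fderiv ℝ (fun y => fderiv ℝ (u p.1) y (EuclideanSpace.single 2 1) 2) p.2 (EuclideanSpace.single 1 1) *
          fderiv ℝ (u p.1) p.2 (EuclideanSpace.single 0 1) 2 = 0 := by
  rw [horizFDeriv_vertStrain_eq_zero_of_umbilic hV hu hpol hdiv humb hp (b := 0) (by decide),
    horizFDeriv_vertStrain_eq_zero_of_umbilic hV hu hpol hdiv humb hp (b := 1) (by decide)]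
  ring

/-! ### The pins of the local statement are open conditions -/

/-- The Jacobian entries `p ↦ ∂_j u_i(p)` are continuous on `V`. [folklore] -/
theorem continuousOn_entry (hu : AnalyticOnNhd ℝ (uncurry u) V) (j i : Fin 3) :
    ContinuousOn (fun p : ℝ × EuclideanSpace ℝ (Fin 3) => fderiv ℝ (u p.1) p.2 (EuclideanSpace.single j 1) i) V := by
  have hJ : AnalyticOnNhd ℝ (jetLetter (fun q : ℝ × EuclideanSpace ℝ (Fin 3) => u q.1 q.2 i)
      [((0 : ℝ), EuclideanSpace.single j (1 : ℝ))]) V :=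
    analyticOnNhd_jetLetter (analyticOnNhd_comp hu i) _
  refine hJ.continuousOn.congr fun p hp => ?_
  rw [jetLetter_cons, jetLetter_nil]
  show fderiv ℝ (u p.1) p.2 (EuclideanSpace.single j 1) i =
    fderiv ℝ (fun q : ℝ × EuclideanSpace ℝ (Fin 3) => u q.1 q.2 i) p (0, EuclideanSpace.single j 1)
  rw [fderiv_spacetime_spatial ((analyticOnNhd_comp hu i) p hp).differentiableAt, fderiv_slice_comp hu hp]

/-- The second entries `p ↦ ∂_{eo}(∂_{ei} u₂)(p)` are continuous on an open `V`. [folklore] -/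
theorem continuousOn_entry₂ (hV : IsOpen V) (hu : AnalyticOnNhd ℝ (uncurry u) V) (eo ei : EuclideanSpace ℝ (Fin 3)) :
    ContinuousOn (fun p : ℝ × EuclideanSpace ℝ (Fin 3) => fderiv ℝ (fun y => fderiv ℝ (u p.1) y ei 2) p.2 eo) V := by
  have hJ : AnalyticOnNhd ℝ (jetLetter (fun q : ℝ × EuclideanSpace ℝ (Fin 3) => u q.1 q.2 2)
      [((0 : ℝ), eo), ((0 : ℝ), ei)]) V :=
    analyticOnNhd_jetLetter (analyticOnNhd_comp hu 2) _
  exact hJ.continuousOn.congr fun p hp => (letterFn_W_second hu hV hp eo ei).symm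

/-- The twist `p ↦ ∂₀(∂₂u₂)∂₁u₂ − ∂₁(∂₂u₂)∂₀u₂` is continuous on an open `V`. [folklore] -/
theorem continuousOn_twist (hV : IsOpen V) (hu : AnalyticOnNhd ℝ (uncurry u) V) :
    ContinuousOn (fun p : ℝ × EuclideanSpace ℝ (Fin 3) =>
      fderiv ℝ (fun y => fderiv ℝ (u p.1) y (EuclideanSpace.single 2 1) 2) p.2 (EuclideanSpace.single 0 1) *
          fderiv ℝ (u p.1) p.2 (EuclideanSpace.single 1 1) 2 -
        fderiv ℝ (fun y => fderiv ℝ (u p.1) y (EuclideanSpace.single 2 1) 2) p.2 (EuclideanSpace.single 1 1) *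
          fderiv ℝ (u p.1) p.2 (EuclideanSpace.single 0 1) 2) V :=
  ((continuousOn_entry₂ hV hu _ _).mul (continuousOn_entry hu 1 2)).sub
    ((continuousOn_entry₂ hV hu _ _).mul (continuousOn_entry hu 0 2))

/-- The slope along the shadow `p ↦ μ(p.1, p.2 2)` is continuous on `V`. [folklore] -/
theorem continuousOn_slope (hμ : ∀ p ∈ V, AnalyticAt ℝ (uncurry μ) (p.1, p.2 2)) :
    ContinuousOn (fun p : ℝ × EuclideanSpace ℝ (Fin 3) => μ p.1 (p.2 2)) V := by
  intro p hp
  have hsh : Continuous fun q : ℝ × EuclideanSpace ℝ (Fin 3) => ((q.1, q.2 2) : ℝ × ℝ) := by fun_prop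
  exact (ContinuousAt.comp (f := fun q : ℝ × EuclideanSpace ℝ (Fin 3) => ((q.1, q.2 2) : ℝ × ℝ)) (x := p)
    (hμ p hp).continuousAt hsh.continuousAt).continuousWithinAt

/-- The vertical slope derivative along the shadow `p ↦ ∂_zμ(p.1, p.2 2)` is continuous on `V`. [folklore] -/
theorem continuousOn_slopeZ (hμ : ∀ p ∈ V, AnalyticAt ℝ (uncurry μ) (p.1, p.2 2)) :
    ContinuousOn (fun p : ℝ × EuclideanSpace ℝ (Fin 3) => deriv (μ p.1) (p.2 2)) V := by
  intro p hp
  have hsh : Continuous fun q : ℝ × EuclideanSpace ℝ (Fin 3) => ((q.1, q.2 2) : ℝ × ℝ) := by fun_prop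
  have key : ∀ q ∈ V, deriv (μ q.1) (q.2 2) = fderiv ℝ (uncurry μ) (q.1, q.2 2) (0, 1) := fun q hq =>
    (hasDerivAt_slices_of_uncurry (p := (q.1, q.2 2)) (hμ q hq).differentiableAt).1.deriv
  have h1 : ContinuousAt (fun r : ℝ × ℝ => fderiv ℝ (uncurry μ) r (0, 1)) (p.1, p.2 2) :=
    ((hμ p hp).fderiv.continuousAt).clm_apply continuousAt_const
  have h2 : ContinuousAt (fun q : ℝ × EuclideanSpace ℝ (Fin 3) => fderiv ℝ (uncurry μ) (q.1, q.2 2) (0, 1)) p :=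
    ContinuousAt.comp (f := fun q : ℝ × EuclideanSpace ℝ (Fin 3) => ((q.1, q.2 2) : ℝ × ℝ)) (x := p)
      h1 hsh.continuousAt
  exact h2.continuousWithinAt.congr (fun q hq => key q hq) (key p hp)

/-! ### The relocation: `hemptyHyp` ⇐ `hemptyHypNU`, `hempty` ⇐ `hemptyNU` -/

/-- **The hyperbolic local (TH)∩twisting statement may assume a NON-UMBILIC base point.**  `hemptyHypNU` is `hemptyHyp`
(twist_split v4.1 `stub_localTHEmptyHyp`, binder for binder) with ONE MORE hypothesis before `False`:
`∂₀u₀(p₀) ≠ ∂₁u₁(p₀) ∨ ∂₁u₀(p₀) ≠ 0` (the trace-free horizontal strain `Φ₂` does not vanish at `p₀`).  Then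
`hemptyHypNU → hemptyHyp`. [folklore] -/
theorem localTHEmptyHyp_of_localTHEmptyHypNonUmbilic
    (hNU : ∀ (u : ℝ → EuclideanSpace ℝ (Fin 3) → EuclideanSpace ℝ (Fin 3)) (μ A : ℝ → ℝ → ℝ)
      (U : Set (ℝ × EuclideanSpace ℝ (Fin 3))) (p₀ : ℝ × EuclideanSpace ℝ (Fin 3)),
      IsOpen U → p₀ ∈ U →
      AnalyticOnNhd ℝ (Function.uncurry u) U →
      (∀ p ∈ U, AnalyticAt ℝ (Function.uncurry μ) (p.1, p.2 2)) →
      (∀ p ∈ U, AnalyticAt ℝ (Function.uncurry A) (p.1, p.2 2)) →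
      (∀ p ∈ U, fderiv ℝ (u p.1) p.2 (EuclideanSpace.single 0 1) 1 = fderiv ℝ (u p.1) p.2 (EuclideanSpace.single 1 1) 0) →
      (∀ p ∈ U, fderiv ℝ (u p.1) p.2 (EuclideanSpace.single 0 1) 0 + fderiv ℝ (u p.1) p.2 (EuclideanSpace.single 1 1) 1 +
        fderiv ℝ (u p.1) p.2 (EuclideanSpace.single 2 1) 2 = 0) →
      (∀ p ∈ U, ∀ b : Fin 3, b ≠ 2 →
        fderiv ℝ (u p.1) p.2 (EuclideanSpace.single 2 1) b =
          μ p.1 (p.2 2) * fderiv ℝ (u p.1) p.2 (EuclideanSpace.single b 1) 2) →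
      (∀ p ∈ U,
        (1 - μ p.1 (p.2 2)) *
            (deriv (fun s => u s p.2 2) p.1 + fderiv ℝ (fun y => u p.1 y 2) p.2 (u p.1 p.2)
              - Δ (fun y => u p.1 y 2) p.2) =
          A p.1 (p.2 2) + (deriv (fun s => μ s (p.2 2)) p.1 - deriv (deriv (μ p.1)) (p.2 2)) * u p.1 p.2 2
            + deriv (μ p.1) (p.2 2) / 2 * u p.1 p.2 2 ^ 2
            - 2 * deriv (μ p.1) (p.2 2) * fderiv ℝ (u p.1) p.2 (EuclideanSpace.single 2 1) 2) →
      fderiv ℝ (fun y => fderiv ℝ (u p₀.1) y (EuclideanSpace.single 2 1) 2) p₀.2 (EuclideanSpace.single 0 1) *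
            fderiv ℝ (u p₀.1) p₀.2 (EuclideanSpace.single 1 1) 2 -
          fderiv ℝ (fun y => fderiv ℝ (u p₀.1) y (EuclideanSpace.single 2 1) 2) p₀.2 (EuclideanSpace.single 1 1) *
            fderiv ℝ (u p₀.1) p₀.2 (EuclideanSpace.single 0 1) 2 ≠ 0 →
      μ p₀.1 (p₀.2 2) ≠ 0 → μ p₀.1 (p₀.2 2) ≠ 1 → deriv (μ p₀.1) (p₀.2 2) ≠ 0 →
      μ p₀.1 (p₀.2 2) < 0 →
      (fderiv ℝ (u p₀.1) p₀.2 (EuclideanSpace.single 0 1) 0 ≠ fderiv ℝ (u p₀.1) p₀.2 (EuclideanSpace.single 1 1) 1 ∨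
        fderiv ℝ (u p₀.1) p₀.2 (EuclideanSpace.single 1 1) 0 ≠ 0) → False) :
    ∀ (u : ℝ → EuclideanSpace ℝ (Fin 3) → EuclideanSpace ℝ (Fin 3)) (μ A : ℝ → ℝ → ℝ)
      (U : Set (ℝ × EuclideanSpace ℝ (Fin 3))) (p₀ : ℝ × EuclideanSpace ℝ (Fin 3)),
      IsOpen U → p₀ ∈ U →
      AnalyticOnNhd ℝ (Function.uncurry u) U →
      (∀ p ∈ U, AnalyticAt ℝ (Function.uncurry μ) (p.1, p.2 2)) →
      (∀ p ∈ U, AnalyticAt ℝ (Function.uncurry A) (p.1, p.2 2)) →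
      (∀ p ∈ U, fderiv ℝ (u p.1) p.2 (EuclideanSpace.single 0 1) 1 = fderiv ℝ (u p.1) p.2 (EuclideanSpace.single 1 1) 0) →
      (∀ p ∈ U, fderiv ℝ (u p.1) p.2 (EuclideanSpace.single 0 1) 0 + fderiv ℝ (u p.1) p.2 (EuclideanSpace.single 1 1) 1 +
        fderiv ℝ (u p.1) p.2 (EuclideanSpace.single 2 1) 2 = 0) →
      (∀ p ∈ U, ∀ b : Fin 3, b ≠ 2 →
        fderiv ℝ (u p.1) p.2 (EuclideanSpace.single 2 1) b =
          μ p.1 (p.2 2) * fderiv ℝ (u p.1) p.2 (EuclideanSpace.single b 1) 2) →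
      (∀ p ∈ U,
        (1 - μ p.1 (p.2 2)) *
            (deriv (fun s => u s p.2 2) p.1 + fderiv ℝ (fun y => u p.1 y 2) p.2 (u p.1 p.2)
              - Δ (fun y => u p.1 y 2) p.2) =
          A p.1 (p.2 2) + (deriv (fun s => μ s (p.2 2)) p.1 - deriv (deriv (μ p.1)) (p.2 2)) * u p.1 p.2 2
            + deriv (μ p.1) (p.2 2) / 2 * u p.1 p.2 2 ^ 2
            - 2 * deriv (μ p.1) (p.2 2) * fderiv ℝ (u p.1) p.2 (EuclideanSpace.single 2 1) 2) →
      fderiv ℝ (fun y => fderiv ℝ (u p₀.1) y (EuclideanSpace.single 2 1) 2) p₀.2 (EuclideanSpace.single 0 1) *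
            fderiv ℝ (u p₀.1) p₀.2 (EuclideanSpace.single 1 1) 2 -
          fderiv ℝ (fun y => fderiv ℝ (u p₀.1) y (EuclideanSpace.single 2 1) 2) p₀.2 (EuclideanSpace.single 1 1) *
            fderiv ℝ (u p₀.1) p₀.2 (EuclideanSpace.single 0 1) 2 ≠ 0 →
      μ p₀.1 (p₀.2 2) ≠ 0 → μ p₀.1 (p₀.2 2) ≠ 1 → deriv (μ p₀.1) (p₀.2 2) ≠ 0 →
      μ p₀.1 (p₀.2 2) < 0 → False := by
  intro u μ A U p₀ hU hp₀ hu hμ hA hpol hdiv hsh hE htw hm0 hm1 hmz hneg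
  -- the pinned open set `G ∋ p₀`
  set tw : ℝ × EuclideanSpace ℝ (Fin 3) → ℝ := fun p =>
    fderiv ℝ (fun y => fderiv ℝ (u p.1) y (EuclideanSpace.single 2 1) 2) p.2 (EuclideanSpace.single 0 1) *
        fderiv ℝ (u p.1) p.2 (EuclideanSpace.single 1 1) 2 -
      fderiv ℝ (fun y => fderiv ℝ (u p.1) y (EuclideanSpace.single 2 1) 2) p.2 (EuclideanSpace.single 1 1) *
        fderiv ℝ (u p.1) p.2 (EuclideanSpace.single 0 1) 2 with htwdef
  set sl : ℝ × EuclideanSpace ℝ (Fin 3) → ℝ := fun p => μ p.1 (p.2 2) with hsldef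
  set slz : ℝ × EuclideanSpace ℝ (Fin 3) → ℝ := fun p => deriv (μ p.1) (p.2 2) with hslzdef
  have hT : IsOpen (({0}ᶜ ∩ {1}ᶜ) ∩ Iio (0 : ℝ)) := (isOpen_compl_singleton.inter isOpen_compl_singleton).inter isOpen_Iio
  set G : Set (ℝ × EuclideanSpace ℝ (Fin 3)) :=
    ((U ∩ tw ⁻¹' {0}ᶜ) ∩ (U ∩ sl ⁻¹' (({0}ᶜ ∩ {1}ᶜ) ∩ Iio 0))) ∩ (U ∩ slz ⁻¹' {0}ᶜ) with hGdef
  have hGo : IsOpen G :=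
    (((continuousOn_twist hU hu).isOpen_inter_preimage hU isOpen_compl_singleton).inter
      ((continuousOn_slope hμ).isOpen_inter_preimage hU hT)).inter
        ((continuousOn_slopeZ hμ).isOpen_inter_preimage hU isOpen_compl_singleton)
  have hp₀G : p₀ ∈ G := by
    refine ⟨⟨⟨hp₀, ?_⟩, hp₀, ?_⟩, hp₀, ?_⟩
    · simpa [htwdef] using htw
    · simpa [hsldef] using ⟨⟨hm0, hm1⟩, hneg⟩
    · simpa [hslzdef] using hmz
  have hGU : G ⊆ U := fun p hp => hp.1.1.1
  -- dichotomy: a non-umbilic point of `G`, or `G` umbilic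
  by_cases hex : ∃ p₁ ∈ G,
      (fderiv ℝ (u p₁.1) p₁.2 (EuclideanSpace.single 0 1) 0 ≠ fderiv ℝ (u p₁.1) p₁.2 (EuclideanSpace.single 1 1) 1 ∨
        fderiv ℝ (u p₁.1) p₁.2 (EuclideanSpace.single 1 1) 0 ≠ 0)
  · obtain ⟨p₁, hp₁G, hΦ⟩ := hex
    have htw₁ : tw p₁ ≠ 0 := by simpa using hp₁G.1.1.2
    have hsl₁ : (sl p₁ ≠ 0 ∧ sl p₁ ≠ 1) ∧ sl p₁ < 0 := by simpa using hp₁G.1.2.2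
    have hslz₁ : slz p₁ ≠ 0 := by simpa using hp₁G.2.2
    exact hNU u μ A U p₁ hU (hGU hp₁G) hu hμ hA hpol hdiv hsh hE htw₁ hsl₁.1.1 hsl₁.1.2 hslz₁ hsl₁.2 hΦ
  · push Not at hex
    exact htw (twist_eq_zero_of_umbilic hGo (hu.mono hGU) (fun p hp => hpol p (hGU hp)) (fun p hp => hdiv p (hGU hp))
      hex hp₀G)

/-- **Sign-free form**: `hempty` (twist_split v4 `stub_localTHEmpty` = local_rigidity S1, binder for binder) ⇐ `hemptyNU`
(`hempty` with the extra hypothesis `∂₀u₀(p₀) ≠ ∂₁u₁(p₀) ∨ ∂₁u₀(p₀) ≠ 0` before `False`).  Exact certificates are sign-blind,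
so this is the form the certificate lane consumes. [folklore] -/
theorem localTHEmpty_of_localTHEmptyNonUmbilic
    (hNU : ∀ (u : ℝ → EuclideanSpace ℝ (Fin 3) → EuclideanSpace ℝ (Fin 3)) (μ A : ℝ → ℝ → ℝ)
      (U : Set (ℝ × EuclideanSpace ℝ (Fin 3))) (p₀ : ℝ × EuclideanSpace ℝ (Fin 3)),
      IsOpen U → p₀ ∈ U →
      AnalyticOnNhd ℝ (Function.uncurry u) U →
      (∀ p ∈ U, AnalyticAt ℝ (Function.uncurry μ) (p.1, p.2 2)) →
      (∀ p ∈ U, AnalyticAt ℝ (Function.uncurry A) (p.1, p.2 2)) →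
      (∀ p ∈ U, fderiv ℝ (u p.1) p.2 (EuclideanSpace.single 0 1) 1 = fderiv ℝ (u p.1) p.2 (EuclideanSpace.single 1 1) 0) →
      (∀ p ∈ U, fderiv ℝ (u p.1) p.2 (EuclideanSpace.single 0 1) 0 + fderiv ℝ (u p.1) p.2 (EuclideanSpace.single 1 1) 1 +
        fderiv ℝ (u p.1) p.2 (EuclideanSpace.single 2 1) 2 = 0) →
      (∀ p ∈ U, ∀ b : Fin 3, b ≠ 2 →
        fderiv ℝ (u p.1) p.2 (EuclideanSpace.single 2 1) b =
          μ p.1 (p.2 2) * fderiv ℝ (u p.1) p.2 (EuclideanSpace.single b 1) 2) →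
      (∀ p ∈ U,
        (1 - μ p.1 (p.2 2)) *
            (deriv (fun s => u s p.2 2) p.1 + fderiv ℝ (fun y => u p.1 y 2) p.2 (u p.1 p.2)
              - Δ (fun y => u p.1 y 2) p.2) =
          A p.1 (p.2 2) + (deriv (fun s => μ s (p.2 2)) p.1 - deriv (deriv (μ p.1)) (p.2 2)) * u p.1 p.2 2
            + deriv (μ p.1) (p.2 2) / 2 * u p.1 p.2 2 ^ 2
            - 2 * deriv (μ p.1) (p.2 2) * fderiv ℝ (u p.1) p.2 (EuclideanSpace.single 2 1) 2) →
      fderiv ℝ (fun y => fderiv ℝ (u p₀.1) y (EuclideanSpace.single 2 1) 2) p₀.2 (EuclideanSpace.single 0 1) *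
            fderiv ℝ (u p₀.1) p₀.2 (EuclideanSpace.single 1 1) 2 -
          fderiv ℝ (fun y => fderiv ℝ (u p₀.1) y (EuclideanSpace.single 2 1) 2) p₀.2 (EuclideanSpace.single 1 1) *
            fderiv ℝ (u p₀.1) p₀.2 (EuclideanSpace.single 0 1) 2 ≠ 0 →
      μ p₀.1 (p₀.2 2) ≠ 0 → μ p₀.1 (p₀.2 2) ≠ 1 → deriv (μ p₀.1) (p₀.2 2) ≠ 0 →
      (fderiv ℝ (u p₀.1) p₀.2 (EuclideanSpace.single 0 1) 0 ≠ fderiv ℝ (u p₀.1) p₀.2 (EuclideanSpace.single 1 1) 1 ∨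
        fderiv ℝ (u p₀.1) p₀.2 (EuclideanSpace.single 1 1) 0 ≠ 0) → False) :
    ∀ (u : ℝ → EuclideanSpace ℝ (Fin 3) → EuclideanSpace ℝ (Fin 3)) (μ A : ℝ → ℝ → ℝ)
      (U : Set (ℝ × EuclideanSpace ℝ (Fin 3))) (p₀ : ℝ × EuclideanSpace ℝ (Fin 3)),
      IsOpen U → p₀ ∈ U →
      AnalyticOnNhd ℝ (Function.uncurry u) U →
      (∀ p ∈ U, AnalyticAt ℝ (Function.uncurry μ) (p.1, p.2 2)) →
      (∀ p ∈ U, AnalyticAt ℝ (Function.uncurry A) (p.1, p.2 2)) →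
      (∀ p ∈ U, fderiv ℝ (u p.1) p.2 (EuclideanSpace.single 0 1) 1 = fderiv ℝ (u p.1) p.2 (EuclideanSpace.single 1 1) 0) →
      (∀ p ∈ U, fderiv ℝ (u p.1) p.2 (EuclideanSpace.single 0 1) 0 + fderiv ℝ (u p.1) p.2 (EuclideanSpace.single 1 1) 1 +
        fderiv ℝ (u p.1) p.2 (EuclideanSpace.single 2 1) 2 = 0) →
      (∀ p ∈ U, ∀ b : Fin 3, b ≠ 2 →
        fderiv ℝ (u p.1) p.2 (EuclideanSpace.single 2 1) b =
          μ p.1 (p.2 2) * fderiv ℝ (u p.1) p.2 (EuclideanSpace.single b 1) 2) →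
      (∀ p ∈ U,
        (1 - μ p.1 (p.2 2)) *
            (deriv (fun s => u s p.2 2) p.1 + fderiv ℝ (fun y => u p.1 y 2) p.2 (u p.1 p.2)
              - Δ (fun y => u p.1 y 2) p.2) =
          A p.1 (p.2 2) + (deriv (fun s => μ s (p.2 2)) p.1 - deriv (deriv (μ p.1)) (p.2 2)) * u p.1 p.2 2
            + deriv (μ p.1) (p.2 2) / 2 * u p.1 p.2 2 ^ 2
            - 2 * deriv (μ p.1) (p.2 2) * fderiv ℝ (u p.1) p.2 (EuclideanSpace.single 2 1) 2) →
      fderiv ℝ (fun y => fderiv ℝ (u p₀.1) y (EuclideanSpace.single 2 1) 2) p₀.2 (EuclideanSpace.single 0 1) *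
            fderiv ℝ (u p₀.1) p₀.2 (EuclideanSpace.single 1 1) 2 -
          fderiv ℝ (fun y => fderiv ℝ (u p₀.1) y (EuclideanSpace.single 2 1) 2) p₀.2 (EuclideanSpace.single 1 1) *
            fderiv ℝ (u p₀.1) p₀.2 (EuclideanSpace.single 0 1) 2 ≠ 0 →
      μ p₀.1 (p₀.2 2) ≠ 0 → μ p₀.1 (p₀.2 2) ≠ 1 → deriv (μ p₀.1) (p₀.2 2) ≠ 0 → False := by
  intro u μ A U p₀ hU hp₀ hu hμ hA hpol hdiv hsh hE htw hm0 hm1 hmz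
  set tw : ℝ × EuclideanSpace ℝ (Fin 3) → ℝ := fun p =>
    fderiv ℝ (fun y => fderiv ℝ (u p.1) y (EuclideanSpace.single 2 1) 2) p.2 (EuclideanSpace.single 0 1) *
        fderiv ℝ (u p.1) p.2 (EuclideanSpace.single 1 1) 2 -
      fderiv ℝ (fun y => fderiv ℝ (u p.1) y (EuclideanSpace.single 2 1) 2) p.2 (EuclideanSpace.single 1 1) *
        fderiv ℝ (u p.1) p.2 (EuclideanSpace.single 0 1) 2 with htwdef
  set sl : ℝ × EuclideanSpace ℝ (Fin 3) → ℝ := fun p => μ p.1 (p.2 2) with hsldef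
  set slz : ℝ × EuclideanSpace ℝ (Fin 3) → ℝ := fun p => deriv (μ p.1) (p.2 2) with hslzdef
  have hT : IsOpen ({0}ᶜ ∩ {1}ᶜ : Set ℝ) := isOpen_compl_singleton.inter isOpen_compl_singleton
  set G : Set (ℝ × EuclideanSpace ℝ (Fin 3)) :=
    ((U ∩ tw ⁻¹' {0}ᶜ) ∩ (U ∩ sl ⁻¹' ({0}ᶜ ∩ {1}ᶜ))) ∩ (U ∩ slz ⁻¹' {0}ᶜ) with hGdef
  have hGo : IsOpen G :=
    (((continuousOn_twist hU hu).isOpen_inter_preimage hU isOpen_compl_singleton).inter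
      ((continuousOn_slope hμ).isOpen_inter_preimage hU hT)).inter
        ((continuousOn_slopeZ hμ).isOpen_inter_preimage hU isOpen_compl_singleton)
  have hp₀G : p₀ ∈ G := by
    refine ⟨⟨⟨hp₀, ?_⟩, hp₀, ?_⟩, hp₀, ?_⟩
    · simpa [htwdef] using htw
    · simpa [hsldef] using ⟨hm0, hm1⟩
    · simpa [hslzdef] using hmz
  have hGU : G ⊆ U := fun p hp => hp.1.1.1
  by_cases hex : ∃ p₁ ∈ G,
      (fderiv ℝ (u p₁.1) p₁.2 (EuclideanSpace.single 0 1) 0 ≠ fderiv ℝ (u p₁.1) p₁.2 (EuclideanSpace.single 1 1) 1 ∨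
        fderiv ℝ (u p₁.1) p₁.2 (EuclideanSpace.single 1 1) 0 ≠ 0)
  · obtain ⟨p₁, hp₁G, hΦ⟩ := hex
    have htw₁ : tw p₁ ≠ 0 := by simpa using hp₁G.1.1.2
    have hsl₁ : sl p₁ ≠ 0 ∧ sl p₁ ≠ 1 := by simpa using hp₁G.1.2.2
    have hslz₁ : slz p₁ ≠ 0 := by simpa using hp₁G.2.2
    exact hNU u μ A U p₁ hU (hGU hp₁G) hu hμ hA hpol hdiv hsh hE htw₁ hsl₁.1 hsl₁.2 hslz₁ hΦ
  · push Not at hex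
    exact htw (twist_eq_zero_of_umbilic hGo (hu.mono hGU) (fun p hp => hpol p (hGU hp)) (fun p hp => hdiv p (hGU hp))
      hex hp₀G)

end Summit.NavierStokesRegularity.NavierStokesRegularity.Theorems.PoloidalWindowDoorLrcModEntireTwistingTHLocalNonUmbilic

end
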